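import Summits.CriticalPhenomena.PercolationContinuityZ3.Theorems.Transplant.KNLevelsTargetPropertyUniformP
import Summits.CriticalPhenomena.PercolationContinuityZ3.Theorems.Transplant.PlanarSkeletonConcDefs
import HarnessLib

/-!
# L7.0′ — ONE `δ` for ALL parameters `q < 1` and ALL subgraphs of a bounded-degree graph (generic U2; design (D)'s "re-run at `q₀ < p`"):
# the p-free constants `ε' ↦ δ_chain ↦ δ₂ ↦ K` of the generic `concChoice` over a `PlanarSkeletonConc`

builds on p205010 (kernel theorem, internal audit signed; external expert review pending) — through `KNLevels.targetPropertyUP_KN`; nothing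
in this file uses p205010 otherwise.
Status sentence (coordinator 2026-08-20T04:30Z): "θ(p_c) = 0 on ℤ^d, all d ≥ 2 — kernel-verified (Lean 4/Mathlib, standard axioms); internal adversarial
audit SIGNED 2026-08-20 04:29Z; external expert review pending."
Lane `prim-bschramm-*`, seat `prim-bschramm-stmt` (gen 7); helper file (`--supports stmt-CriticalPhenomena-4575`).
GENERAL-NODE programme (SHEAR-SCOPE §3.9 Layer 7, §stmt item 1; CONC-PARAMS-GENERIC.md §1 rows δA/δUP): the product's `BoxProdZ2ChainUP`
(p221091) §1 with `X □ zdGraph 2 ↦ G` and the degree parameter `Δ + 4 ↦ Δ`.  The product's §2 (window TUBE graphs `tubeGraph X π`) needs no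
twin: every window graph of the generic re-typing (`winGraph R` of L5.1, or any other finite piece) is a subgraph `G' ≤ G`, and §1 quantifies
over all of them — consumers pass `(winGraph_le …)` where the product passed `π`.

* **`SkelConc.apply_step_subgraph_UP`** — `∃ δ ∈ (0,1], ∀ q < 1, ∀ G' ≤ G, …` one application of the target lemma (the `hstep` shape);
* **`SkelConc.chain_subgraph_UP`**, **`SkelConc.chain_edge_subgraph_UP`** — chains (with enlarged targets: true targets `T'_i ⊆ T_i`, excess
  `≤ η ≤ δ/2`) of `n + 1` steps (the `hchain` shape);
* `PlanarSkeletonConc.apply_step_UP / chain_UP / chain_edge_UP` — the same for the subgraphs of a graph carrying a `PlanarSkeletonConc Φ`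
  (degree bound = the field `Φ.degree_le`, `Δ := Φ.Δ`).
So, as in the product (refuter p5-g3's D13), the generic instance fixes `ε' ↦ δ_chain ↦ δ₂ ↦ K` BEFORE `p`, and one input accuracy at `p`
serves every `q ∈ [p/2, p]`.
[cite: KozmaNitzan2024, §4 Lemma 10 (p. 17), Lemma 11 (p. 22), Lemma 12 (pp. 23–25)]
-/

noncomputable section

open MeasureTheory ProbabilityTheory

namespace Summit.CriticalPhenomena.PercolationContinuityZ3.Theorems

namespace Transplant

open Literature.Probability.Percolation Literature.Probability.LatticeModels SimpleGraph KNLevels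

namespace SkelConc

variable {V : Type} [DecidableEq V] [Countable V] (G : SimpleGraph V) [G.LocallyFinite]

/-! ## §1 One `δ` for all parameters and all subgraphs of a bounded-degree graph -/

omit [DecidableEq V] [Countable V] [G.LocallyFinite] in
/-- Subgraphs of a graph with degrees `≤ Δ` have degrees `≤ Δ` (any `LocallyFinite` instances). [folklore] -/
theorem degree_le_of_subgraph [G.LocallyFinite] {Δ : ℕ} (hΔ : ∀ v, G.degree v ≤ Δ) (G' : SimpleGraph V) [G'.LocallyFinite]
    (hG' : G' ≤ G) (v : V) : G'.degree v ≤ Δ := by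
  classical
  exact (SimpleGraph.degree_le_of_le hG').trans (hΔ v)

/-- **One application, uniformly over the parameters `q < 1` and the subgraphs of `G`.** [cite: KozmaNitzan2024, §4 Lemma 10 (p. 17)] -/
theorem apply_step_subgraph_UP {Δ : ℕ} (hΔ : ∀ v, G.degree v ≤ Δ) {ε : ℝ} (hε : 0 < ε) :
    ∃ δ : ℝ, 0 < δ ∧ δ ≤ 1 ∧ ∀ (q : unitInterval), (q : ℝ) < 1 → ∀ (G' : SimpleGraph V) [G'.LocallyFinite], G' ≤ G →
      ∀ (Wt : Sym2 V → unitInterval) (s : TStep G'), s.KitsAt Wt q Δ δ →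
      1 - δ < (prodBernoulli Wt).real s.L.reachB → 1 - ε < (prodBernoulli Wt).real (⋃ t ∈ s.T, openConn s.L.o t) := by
  obtain ⟨δ, hδ, hδ1, h⟩ := (targetPropertyUP_KN (V := V) (Δ := Δ)).apply_step hε
  exact ⟨δ, hδ, hδ1, fun q hq1 G' _ hG' => h q hq1 G' (degree_le_of_subgraph G hΔ G' hG')⟩

/-- **Chains, uniformly over the parameters `q < 1` and the subgraphs of `G`**: for `ε > 0` and `n` ONE `δ ∈ (0, 1]` such that at EVERY
`q < 1`, in EVERY subgraph `G' ≤ G`, for every weighting and every linked chain of `n + 1` target steps with kits at accuracy `δ`,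
`1 − δ < P(o ↔ X_0(0))` gives `1 − ε < P(o ↔ T_n)`. [cite: KozmaNitzan2024, §4 Lemma 11 (p. 22), Lemma 12 (p. 24)] -/
theorem chain_subgraph_UP {Δ : ℕ} (hΔ : ∀ v, G.degree v ≤ Δ) (n : ℕ) {ε : ℝ} (hε : 0 < ε) :
    ∃ δ : ℝ, 0 < δ ∧ δ ≤ 1 ∧ ∀ (q : unitInterval), (q : ℝ) < 1 → ∀ (G' : SimpleGraph V) [G'.LocallyFinite], G' ≤ G →
      ∀ (Wt : Sym2 V → unitInterval) (s : Fin (n + 1) → TStep G'),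
      (∀ i : Fin (n + 1), (s i).L.o = (s 0).L.o) →
      (∀ i : Fin n, (s (Fin.castSucc i)).T ⊆ (s i.succ).L.X 0) →
      (∀ i : Fin (n + 1), (s i).KitsAt Wt q Δ δ) →
      1 - δ < (prodBernoulli Wt).real (s 0).L.reachB →
        1 - ε < (prodBernoulli Wt).real (⋃ t ∈ (s (Fin.last n)).T, openConn (s 0).L.o t) := by
  obtain ⟨δ, hδ, hδ1, h⟩ := (targetPropertyUP_KN (V := V) (Δ := Δ)).chain n hε
  exact ⟨δ, hδ, hδ1, fun q hq1 G' _ hG' => h q hq1 G' (degree_le_of_subgraph G hΔ G' hG')⟩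

/-- **Chains with enlarged targets, uniformly over the parameters `q < 1` and the subgraphs of `G`** (true targets `T'_i ⊆ T_i`, excess
`≤ η ≤ δ/2`) — the `hchain` hypothesis of the corridor chains of design (D) for every parameter at once: the scheme's `δc := δ_chain(ε')` is
fixed before `p`. [cite: KozmaNitzan2024, §4 Lemma 11 (p. 22), Lemma 12 (pp. 23–25)] -/
theorem chain_edge_subgraph_UP {Δ : ℕ} (hΔ : ∀ v, G.degree v ≤ Δ) (n : ℕ) {ε : ℝ} (hε : 0 < ε) :
    ∃ δ : ℝ, 0 < δ ∧ δ ≤ 1 ∧ ∀ (q : unitInterval), (q : ℝ) < 1 → ∀ (G' : SimpleGraph V) [G'.LocallyFinite], G' ≤ G →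
      ∀ (Wt : Sym2 V → unitInterval) (s : Fin (n + 1) → TStep G') (T' : Fin (n + 1) → Finset V) (η : ℝ),
      (∀ i : Fin (n + 1), (s i).L.o = (s 0).L.o) →
      (∀ i : Fin n, T' (Fin.castSucc i) ⊆ (s i.succ).L.X 0) →
      (∀ i : Fin (n + 1), T' i ⊆ (s i).T) →
      (∀ i : Fin (n + 1), (s i).KitsAt Wt q Δ δ) →
      η ≤ δ / 2 →
      (∀ i : Fin (n + 1), (prodBernoulli Wt).real (⋃ t ∈ (s i).T \ T' i, openConn (s 0).L.o t) ≤ η) →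
      1 - δ < (prodBernoulli Wt).real (s 0).L.reachB →
        1 - ε < (prodBernoulli Wt).real (⋃ t ∈ T' (Fin.last n), openConn (s 0).L.o t) := by
  obtain ⟨δ, hδ, hδ1, h⟩ := (targetPropertyUP_KN (V := V) (Δ := Δ)).chain_edge n hε
  exact ⟨δ, hδ, hδ1, fun q hq1 G' _ hG' => h q hq1 G' (degree_le_of_subgraph G hΔ G' hG')⟩

end SkelConc

/-! ## §2 The subgraphs of a graph carrying a `PlanarSkeletonConc` (degree bound = the field `degree_le`) -/

namespace PlanarSkeletonConc

open SkelConc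

variable {V : Type} [DecidableEq V] [Countable V] {G : SimpleGraph V} [G.LocallyFinite] (Φ : PlanarSkeletonConc G)

/-- **One application, uniformly over `q < 1` and the subgraphs of a graph with a `PlanarSkeletonConc`** (degree parameter `Φ.Δ`).
[cite: KozmaNitzan2024, §4 Lemma 10 (p. 17)] -/
theorem apply_step_UP {ε : ℝ} (hε : 0 < ε) :
    ∃ δ : ℝ, 0 < δ ∧ δ ≤ 1 ∧ ∀ (q : unitInterval), (q : ℝ) < 1 → ∀ (G' : SimpleGraph V) [G'.LocallyFinite], G' ≤ G →
      ∀ (Wt : Sym2 V → unitInterval) (s : TStep G'), s.KitsAt Wt q Φ.Δ δ →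
      1 - δ < (prodBernoulli Wt).real s.L.reachB → 1 - ε < (prodBernoulli Wt).real (⋃ t ∈ s.T, openConn s.L.o t) :=
  apply_step_subgraph_UP G Φ.degree_le hε

/-- **Chains, uniformly over `q < 1` and the subgraphs of a graph with a `PlanarSkeletonConc`.** [cite: KozmaNitzan2024, §4 Lemma 11 (p. 22), Lemma 12 (p. 24)] -/
theorem chain_UP (n : ℕ) {ε : ℝ} (hε : 0 < ε) :
    ∃ δ : ℝ, 0 < δ ∧ δ ≤ 1 ∧ ∀ (q : unitInterval), (q : ℝ) < 1 → ∀ (G' : SimpleGraph V) [G'.LocallyFinite], G' ≤ G →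
      ∀ (Wt : Sym2 V → unitInterval) (s : Fin (n + 1) → TStep G'),
      (∀ i : Fin (n + 1), (s i).L.o = (s 0).L.o) →
      (∀ i : Fin n, (s (Fin.castSucc i)).T ⊆ (s i.succ).L.X 0) →
      (∀ i : Fin (n + 1), (s i).KitsAt Wt q Φ.Δ δ) →
      1 - δ < (prodBernoulli Wt).real (s 0).L.reachB →
        1 - ε < (prodBernoulli Wt).real (⋃ t ∈ (s (Fin.last n)).T, openConn (s 0).L.o t) :=
  chain_subgraph_UP G Φ.degree_le n hε

/-- **Chains with enlarged targets, uniformly over `q < 1` and the subgraphs of a graph with a `PlanarSkeletonConc`** (the `hchain` shape of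
the generic corridor chains). [cite: KozmaNitzan2024, §4 Lemma 11 (p. 22), Lemma 12 (pp. 23–25)] -/
theorem chain_edge_UP (n : ℕ) {ε : ℝ} (hε : 0 < ε) :
    ∃ δ : ℝ, 0 < δ ∧ δ ≤ 1 ∧ ∀ (q : unitInterval), (q : ℝ) < 1 → ∀ (G' : SimpleGraph V) [G'.LocallyFinite], G' ≤ G →
      ∀ (Wt : Sym2 V → unitInterval) (s : Fin (n + 1) → TStep G') (T' : Fin (n + 1) → Finset V) (η : ℝ),
      (∀ i : Fin (n + 1), (s i).L.o = (s 0).L.o) →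
      (∀ i : Fin n, T' (Fin.castSucc i) ⊆ (s i.succ).L.X 0) →
      (∀ i : Fin (n + 1), T' i ⊆ (s i).T) →
      (∀ i : Fin (n + 1), (s i).KitsAt Wt q Φ.Δ δ) →
      η ≤ δ / 2 →
      (∀ i : Fin (n + 1), (prodBernoulli Wt).real (⋃ t ∈ (s i).T \ T' i, openConn (s 0).L.o t) ≤ η) →
      1 - δ < (prodBernoulli Wt).real (s 0).L.reachB →
        1 - ε < (prodBernoulli Wt).real (⋃ t ∈ T' (Fin.last n), openConn (s 0).L.o t) :=
  chain_edge_subgraph_UP G Φ.degree_le n hε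

end PlanarSkeletonConc

end Transplant

end Summit.CriticalPhenomena.PercolationContinuityZ3.Theorems

end
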